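import Mathlib.Analysis.InnerProductSpace.Basic
import Mathlib.Data.ZMod.Basic
import HarnessLib

/-!
# NE7LineSumGramBounds — (α_S) AT THE FLAT BACKGROUND, ITS ARITHMETIC CORE: the Gram quadratic form of the straight block-line sum of length `M`
# (adjoint = the longitudinal linear interpolation with weights `(r+1, M−1−r)`, `NE3StraightAverageAdjoint.Wad`) is TWO-SIDED,
# `M(M²+2)∕3·Σ‖ω‖² ≤ Σ_z Σ_{r<M} ‖(r+1)•ω(z) + (M−1−r)•ω(z−1)‖² ≤ M³·Σ‖ω‖²` on a periodic coarse line

Cell `pub-balaban`, rung (B)+1 sub-cell t4, lineage `b2b-balaban-t4-ne7-p1`, generation 62 (CRUX PROVER NE7 #1, ruling e34b3e0c (2)); hunt (h7)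
«ENERGY ROAD», memo v2 §(43h)∕§6 (`t4/b2b-balaban-t4-ne7-p1-g62/HUNT-H7-ENERGY-ROAD-v2.md`), hunt question (h7-d).  WHY.  After gen 62 the energy road's
analytic residual (α_S) is a two-sided bound `λ‖μ‖² ≤ ‖S†μ‖² ≤ Λ²‖μ‖²` for the adjoint of the STRAIGHT linearised average
(`NE7TensionKernelCoercivity.coercive_of_adjoint_lower_bound` ∕ `opNorm_le_of_adjoint_upper_bound`, v1.4), and at the flat background the adjoint of the
block-line sum `T z κ = Σ_{v∈[0,M)^d} Σ_{i<M} Y(M•z + v + i e_κ) κ` is the longitudinal linear interpolation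
`Wad ω x κ = (r_κ(x)+1)•ω(z(x)) κ + (M−1−r_κ(x))•ω(z(x)−e_κ) κ` (the NE3 swarm's `NE3StraightAverageAdjoint.sum_inner_lineSum_eq_sum_inner_Wad`).  Its
square norm per transverse line is the sum treated HERE, in a vocabulary-free form (a periodic coarse line `ZMod N_c → V`, `V` any real inner-product
space): **`lineSum_gram_lower`** `(M(M²+2)∕3)·Σ_z‖ω z‖² ≤ Σ_z Σ_{r<M} ‖(r+1)•ω z + (M−1−r)•ω(z−1)‖²` and **`lineSum_gram_upper`** `… ≤ M³·Σ_z‖ω z‖²`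
(so the symbol lies in `[M(M²+2)∕3, M³]`, ratio `≤ 3`, the located number of idea-1 g43 INBOX l.31670 and of §(43h)); §1 the two weight sums
`Σ_{r<M} ((r+1) − (M−1−r))² = M(M²+2)∕3`, `Σ_{r<M} ((r+1) + (M−1−r))² = M³`; §2 the pointwise expansion and the periodic shift `Σ_z‖ω(z−1)‖² = Σ_z‖ω z‖²`.
What it does NOT do: the transfer to the tree's `Wad`∕`cdiv`∕`cmod` vocabulary and the normalisation `M^{−2d}·M^{d−1}` (transverse multiplicity) — bookkeeping
for the seat that assembles (α_S); the CURVED small-field case (Ad-transports along the line) is not touched.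
HONEST FRAMING (page 1): elementary sums; nothing about Bałaban's minimisers; NE7, NE3 NOT PRINTED in [Balaban1984PropagatorsI]–[Balaban1989LargeFieldII] and
NOT PROVED; FIXED FINITE torus, rung (B)+1; continuum YM on T⁴ ⇐ BetaPertH ∧ nine spine estimates (0/9 proved); BetaPertH ⇐ (D1) ∧ (D4) ∧ CAP+tail;
G-an2-4 gates asym, D1 and NE2/3/4; NOT infinite volume, NOT mass gap, NOT Clay.  0 def, 0 sorry.
-/

set_option autoImplicit false

open scoped BigOperators InnerProductSpace
open Finset

namespace Summit.QuantumFields.BalabanUV.T4Continuum.NE7LineSumGramBounds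

/-! ## §1 The weight sums -/

/-- `2·Σ_{r<M} (r+1) = M(M+1)`. [folklore] -/
theorem two_mul_sum_succ (M : ℕ) : 2 * ∑ r ∈ range M, ((r : ℝ) + 1) = (M : ℝ) * ((M : ℝ) + 1) := by
  induction M with
  | zero => simp
  | succ m ih => rw [Finset.sum_range_succ, mul_add, ih]; push_cast; ring

/-- `6·Σ_{r<M} (r+1)² = M(M+1)(2M+1)`. [folklore] -/
theorem six_mul_sum_succ_sq (M : ℕ) : 6 * ∑ r ∈ range M, ((r : ℝ) + 1) ^ 2 = (M : ℝ) * ((M : ℝ) + 1) * (2 * (M : ℝ) + 1) := by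
  induction M with
  | zero => simp
  | succ m ih => rw [Finset.sum_range_succ, mul_add, ih]; push_cast; ring

/-- **THE LOWER WEIGHT SUM**: `Σ_{r<M} ((r+1) − (M−1−r))² = M(M²+2)∕3`. [folklore] -/
theorem sum_weight_diff_sq (M : ℕ) :
    ∑ r ∈ range M, (((r : ℝ) + 1) - ((M : ℝ) - 1 - r)) ^ 2 = (M : ℝ) * ((M : ℝ) ^ 2 + 2) / 3 := by
  have h1 := two_mul_sum_succ M
  have h2 := six_mul_sum_succ_sq M
  have e : ∀ r : ℕ, (((r : ℝ) + 1) - ((M : ℝ) - 1 - r)) ^ 2 = 4 * ((r : ℝ) + 1) ^ 2 - 4 * (M : ℝ) * ((r : ℝ) + 1) + (M : ℝ) ^ 2 := by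
    intro r; ring
  rw [Finset.sum_congr rfl (fun r _ => e r), Finset.sum_add_distrib, Finset.sum_sub_distrib, ← Finset.mul_sum, ← Finset.mul_sum,
    Finset.sum_const, Finset.card_range, nsmul_eq_mul]
  linear_combination (2 / 3 : ℝ) * h2 - 2 * (M : ℝ) * h1

/-- **THE UPPER WEIGHT SUM**: `Σ_{r<M} ((r+1) + (M−1−r))² = M³`. [folklore] -/
theorem sum_weight_add_sq (M : ℕ) : ∑ r ∈ range M, (((r : ℝ) + 1) + ((M : ℝ) - 1 - r)) ^ 2 = (M : ℝ) ^ 3 := by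
  have e : ∀ r : ℕ, (((r : ℝ) + 1) + ((M : ℝ) - 1 - r)) ^ 2 = (M : ℝ) ^ 2 := by intro r; ring
  simp only [e, Finset.sum_const, Finset.card_range, nsmul_eq_mul]
  ring

/-! ## §2 The two-sided Gram bound on a periodic coarse line -/

section Line

variable {V : Type*} [NormedAddCommGroup V] [InnerProductSpace ℝ V] {Nc : ℕ} [NeZero Nc]

omit [InnerProductSpace ℝ V] in
/-- The periodic shift: `Σ_z ‖ω(z−1)‖² = Σ_z ‖ω z‖²` on `ZMod N_c`. [folklore] -/
theorem sum_norm_sq_shift (ω : ZMod Nc → V) : ∑ z : ZMod Nc, ‖ω (z - 1)‖ ^ 2 = ∑ z : ZMod Nc, ‖ω z‖ ^ 2 :=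
  Fintype.sum_equiv (Equiv.subRight (1 : ZMod Nc)) _ _ fun _ => rfl

/-- The pointwise expansion `‖p•a + q•b‖² = p²‖a‖² + q²‖b‖² + 2pq⟪a,b⟫`. [folklore] -/
theorem norm_sq_weighted (p q : ℝ) (a b : V) :
    ‖p • a + q • b‖ ^ 2 = p ^ 2 * ‖a‖ ^ 2 + q ^ 2 * ‖b‖ ^ 2 + 2 * (p * q) * ⟪a, b⟫_ℝ := by
  rw [← real_inner_self_eq_norm_sq, inner_add_left, inner_add_right, inner_add_right, real_inner_smul_left, real_inner_smul_left,
    real_inner_smul_right, real_inner_smul_right, real_inner_smul_left, real_inner_smul_left, real_inner_smul_right, real_inner_smul_right,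
    real_inner_self_eq_norm_sq, real_inner_self_eq_norm_sq, real_inner_comm a b]
  ring

/-- **THE LOWER GRAM BOUND** (`λ` of (α_S) at the flat background, per transverse line, unnormalised):
`(M(M²+2)∕3)·Σ_z ‖ω z‖² ≤ Σ_z Σ_{r<M} ‖(r+1)•ω z + (M−1−r)•ω(z−1)‖²` — AM–GM on the cross terms (the weights `(r+1)(M−1−r)` are `≥ 0`), the periodic
shift, and `Σ_r ((r+1) − (M−1−r))² = M(M²+2)∕3`. [folklore] -/
theorem lineSum_gram_lower (M : ℕ) (ω : ZMod Nc → V) :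
    (M : ℝ) * ((M : ℝ) ^ 2 + 2) / 3 * ∑ z : ZMod Nc, ‖ω z‖ ^ 2
      ≤ ∑ z : ZMod Nc, ∑ r ∈ range M, ‖((r : ℝ) + 1) • ω z + ((M : ℝ) - 1 - r) • ω (z - 1)‖ ^ 2 := by
  -- pointwise lower bound with the cross term replaced by `−pq(‖a‖² + ‖b‖²)`
  have hpt : ∀ (z : ZMod Nc) (r : ℕ), r ∈ range M →
      ((r : ℝ) + 1) ^ 2 * ‖ω z‖ ^ 2 + ((M : ℝ) - 1 - r) ^ 2 * ‖ω (z - 1)‖ ^ 2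
        - (((r : ℝ) + 1) * ((M : ℝ) - 1 - r)) * (‖ω z‖ ^ 2 + ‖ω (z - 1)‖ ^ 2)
        ≤ ‖((r : ℝ) + 1) • ω z + ((M : ℝ) - 1 - r) • ω (z - 1)‖ ^ 2 := by
    intro z r hr
    rw [norm_sq_weighted]
    have hr' : (r : ℝ) + 1 ≤ M := by have := Finset.mem_range.mp hr; exact_mod_cast this
    have hpq : 0 ≤ ((r : ℝ) + 1) * ((M : ℝ) - 1 - r) := mul_nonneg (by positivity) (by linarith)
    -- `2⟪a,b⟫ ≥ −(‖a‖² + ‖b‖²)`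
    have hcs : -(‖ω z‖ ^ 2 + ‖ω (z - 1)‖ ^ 2) ≤ 2 * ⟪ω z, ω (z - 1)⟫_ℝ := by
      have h := norm_add_sq_real (ω z) (ω (z - 1))
      nlinarith [norm_nonneg (ω z + ω (z - 1)), sq_nonneg ‖ω z + ω (z - 1)‖]
    nlinarith [mul_le_mul_of_nonneg_left hcs hpq]
  -- sum over `r` and `z`
  have hsum := Finset.sum_le_sum fun z (_ : z ∈ (Finset.univ : Finset (ZMod Nc))) => Finset.sum_le_sum fun r hr => hpt z r hr
  refine le_trans (le_of_eq ?_) hsum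
  -- evaluate the left-hand side: split, shift, and use the weight sum
  simp only [Finset.sum_sub_distrib, Finset.sum_add_distrib, mul_add]
  have eA : ∑ z : ZMod Nc, ∑ r ∈ range M, ((r : ℝ) + 1) ^ 2 * ‖ω z‖ ^ 2 = (∑ r ∈ range M, ((r : ℝ) + 1) ^ 2) * ∑ z : ZMod Nc, ‖ω z‖ ^ 2 := by
    rw [Finset.sum_mul]; rw [Finset.sum_comm]; exact Finset.sum_congr rfl fun r _ => by rw [Finset.mul_sum]
  have eB : ∑ z : ZMod Nc, ∑ r ∈ range M, ((M : ℝ) - 1 - r) ^ 2 * ‖ω (z - 1)‖ ^ 2 = (∑ r ∈ range M, ((M : ℝ) - 1 - r) ^ 2) * ∑ z : ZMod Nc, ‖ω z‖ ^ 2 := by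
    rw [← sum_norm_sq_shift ω, Finset.sum_mul, Finset.sum_comm]; exact Finset.sum_congr rfl fun r _ => by rw [Finset.mul_sum]
  have eC : ∑ z : ZMod Nc, ∑ r ∈ range M, ((r : ℝ) + 1) * ((M : ℝ) - 1 - r) * ‖ω z‖ ^ 2
      = (∑ r ∈ range M, ((r : ℝ) + 1) * ((M : ℝ) - 1 - r)) * ∑ z : ZMod Nc, ‖ω z‖ ^ 2 := by
    rw [Finset.sum_mul, Finset.sum_comm]; exact Finset.sum_congr rfl fun r _ => by rw [Finset.mul_sum]
  have eD : ∑ z : ZMod Nc, ∑ r ∈ range M, ((r : ℝ) + 1) * ((M : ℝ) - 1 - r) * ‖ω (z - 1)‖ ^ 2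
      = (∑ r ∈ range M, ((r : ℝ) + 1) * ((M : ℝ) - 1 - r)) * ∑ z : ZMod Nc, ‖ω z‖ ^ 2 := by
    rw [← sum_norm_sq_shift ω, Finset.sum_mul, Finset.sum_comm]; exact Finset.sum_congr rfl fun r _ => by rw [Finset.mul_sum]
  rw [eA, eB, eC, eD]
  have hw := sum_weight_diff_sq M
  have e : ∑ r ∈ range M, (((r : ℝ) + 1) - ((M : ℝ) - 1 - r)) ^ 2
      = ∑ r ∈ range M, ((r : ℝ) + 1) ^ 2 + ∑ r ∈ range M, ((M : ℝ) - 1 - r) ^ 2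
        - (∑ r ∈ range M, ((r : ℝ) + 1) * ((M : ℝ) - 1 - r) + ∑ r ∈ range M, ((r : ℝ) + 1) * ((M : ℝ) - 1 - r)) := by
    rw [← Finset.sum_add_distrib, ← Finset.sum_add_distrib, ← Finset.sum_sub_distrib]
    exact Finset.sum_congr rfl fun r _ => by ring
  rw [e] at hw
  linear_combination (-(∑ z : ZMod Nc, ‖ω z‖ ^ 2)) * hw

/-- **THE UPPER GRAM BOUND** (`Λ²` of (α_S) at the flat background, per transverse line, unnormalised):
`Σ_z Σ_{r<M} ‖(r+1)•ω z + (M−1−r)•ω(z−1)‖² ≤ M³·Σ_z ‖ω z‖²` — so the symbol ratio is `≤ 3M³∕(M(M²+2)) ≤ 3`. [folklore] -/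
theorem lineSum_gram_upper (M : ℕ) (ω : ZMod Nc → V) :
    ∑ z : ZMod Nc, ∑ r ∈ range M, ‖((r : ℝ) + 1) • ω z + ((M : ℝ) - 1 - r) • ω (z - 1)‖ ^ 2
      ≤ (M : ℝ) ^ 3 * ∑ z : ZMod Nc, ‖ω z‖ ^ 2 := by
  have hpt : ∀ (z : ZMod Nc) (r : ℕ), r ∈ range M →
      ‖((r : ℝ) + 1) • ω z + ((M : ℝ) - 1 - r) • ω (z - 1)‖ ^ 2
        ≤ ((r : ℝ) + 1) ^ 2 * ‖ω z‖ ^ 2 + ((M : ℝ) - 1 - r) ^ 2 * ‖ω (z - 1)‖ ^ 2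
          + (((r : ℝ) + 1) * ((M : ℝ) - 1 - r)) * (‖ω z‖ ^ 2 + ‖ω (z - 1)‖ ^ 2) := by
    intro z r hr
    rw [norm_sq_weighted]
    have hr' : (r : ℝ) + 1 ≤ M := by have := Finset.mem_range.mp hr; exact_mod_cast this
    have hpq : 0 ≤ ((r : ℝ) + 1) * ((M : ℝ) - 1 - r) := mul_nonneg (by positivity) (by linarith)
    -- `2⟪a,b⟫ ≤ ‖a‖² + ‖b‖²`
    have hcs : 2 * ⟪ω z, ω (z - 1)⟫_ℝ ≤ ‖ω z‖ ^ 2 + ‖ω (z - 1)‖ ^ 2 := by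
      have h := norm_sub_sq_real (ω z) (ω (z - 1))
      nlinarith [sq_nonneg ‖ω z - ω (z - 1)‖]
    nlinarith [mul_le_mul_of_nonneg_left hcs hpq]
  have hsum := Finset.sum_le_sum fun z (_ : z ∈ (Finset.univ : Finset (ZMod Nc))) => Finset.sum_le_sum fun r hr => hpt z r hr
  refine hsum.trans (le_of_eq ?_)
  simp only [Finset.sum_add_distrib, mul_add]
  have eA : ∑ z : ZMod Nc, ∑ r ∈ range M, ((r : ℝ) + 1) ^ 2 * ‖ω z‖ ^ 2 = (∑ r ∈ range M, ((r : ℝ) + 1) ^ 2) * ∑ z : ZMod Nc, ‖ω z‖ ^ 2 := by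
    rw [Finset.sum_mul]; rw [Finset.sum_comm]; exact Finset.sum_congr rfl fun r _ => by rw [Finset.mul_sum]
  have eB : ∑ z : ZMod Nc, ∑ r ∈ range M, ((M : ℝ) - 1 - r) ^ 2 * ‖ω (z - 1)‖ ^ 2 = (∑ r ∈ range M, ((M : ℝ) - 1 - r) ^ 2) * ∑ z : ZMod Nc, ‖ω z‖ ^ 2 := by
    rw [← sum_norm_sq_shift ω, Finset.sum_mul, Finset.sum_comm]; exact Finset.sum_congr rfl fun r _ => by rw [Finset.mul_sum]
  have eC : ∑ z : ZMod Nc, ∑ r ∈ range M, ((r : ℝ) + 1) * ((M : ℝ) - 1 - r) * ‖ω z‖ ^ 2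
      = (∑ r ∈ range M, ((r : ℝ) + 1) * ((M : ℝ) - 1 - r)) * ∑ z : ZMod Nc, ‖ω z‖ ^ 2 := by
    rw [Finset.sum_mul, Finset.sum_comm]; exact Finset.sum_congr rfl fun r _ => by rw [Finset.mul_sum]
  have eD : ∑ z : ZMod Nc, ∑ r ∈ range M, ((r : ℝ) + 1) * ((M : ℝ) - 1 - r) * ‖ω (z - 1)‖ ^ 2
      = (∑ r ∈ range M, ((r : ℝ) + 1) * ((M : ℝ) - 1 - r)) * ∑ z : ZMod Nc, ‖ω z‖ ^ 2 := by
    rw [← sum_norm_sq_shift ω, Finset.sum_mul, Finset.sum_comm]; exact Finset.sum_congr rfl fun r _ => by rw [Finset.mul_sum]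
  rw [eA, eB, eC, eD]
  have hw := sum_weight_add_sq M
  have e : ∑ r ∈ range M, (((r : ℝ) + 1) + ((M : ℝ) - 1 - r)) ^ 2
      = ∑ r ∈ range M, ((r : ℝ) + 1) ^ 2 + ∑ r ∈ range M, ((M : ℝ) - 1 - r) ^ 2
        + (∑ r ∈ range M, ((r : ℝ) + 1) * ((M : ℝ) - 1 - r) + ∑ r ∈ range M, ((r : ℝ) + 1) * ((M : ℝ) - 1 - r)) := by
    rw [← Finset.sum_add_distrib, ← Finset.sum_add_distrib, ← Finset.sum_add_distrib]
    exact Finset.sum_congr rfl fun r _ => by ring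
  rw [e] at hw
  linear_combination (∑ z : ZMod Nc, ‖ω z‖ ^ 2) * hw

end Line

end Summit.QuantumFields.BalabanUV.T4Continuum.NE7LineSumGramBounds
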